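import Mathlib

/-!
# The decorated colength splits: `ℓ(R/(aJ + (g))) = ℓ(R/((a) + (g))) + ℓ(R/(J + (g)))`

(crux stmt-ResolutionOfSingularities-15640 `WildQuotients.WildQuotientResolution`, R-lane of
`L/w45c/CHAIN.md` v7.9: ideator res-L1-w45c-idea-1, card H `decorated-colength-law`, first checkable
step H1 `stub_decoratedColength_split` of `L/res-L1-w45c-idea-1/Sketch-L1-idea-1.lean` v6 §H;
named to this seat by res-L1-w45c-plan-1 2026-08-27T09:38:47Z.
[OURS · L1 W4.5c] — NOT a statement of any manuscript; replaces the role of no printed item.)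

Pure commutative algebra (Mathlib only). For a commutative ring `R`, an ideal `J` and elements
`a g` with `((g) : a) = (g)` — i.e. `a r ∈ (g) ⇒ r ∈ (g)` — the lengths of the three quotients
satisfy
`ℓ_R (R ⧸ (aJ + (g))) = ℓ_R (R ⧸ ((a) + (g))) + ℓ_R (R ⧸ (J + (g)))` in `ℕ∞`
(`DecoratedColength.length_quotient_span_mul_sup_span`). Proof: multiplication by `a` induces an
`R`-linear map `R ⧸ (J + (g)) → R ⧸ (aJ + (g))`; it is injective exactly by the colon hypothesis
(`a r = a j + g s ⇒ a (r - j) ∈ (g) ⇒ r - j ∈ (g)`), its range is `((a) + (g)) ⧸ (aJ + (g))`, the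
kernel of the projection `R ⧸ (aJ + (g)) → R ⧸ ((a) + (g))`, and `Module.length` is additive on short
exact sequences (Mathlib `Module.length_eq_add_of_exact`). In the decorated planar game of card H
(`a = M̄` the residual boundary monomial, `g = ḡ` the residual passenger, coprime) this is the split
`λ = i_P(M̄, ḡ) + κ` of the decorated colength. The idea card's extra hypothesis
`a ∈ nonZeroDivisors R` is not needed and is dropped: idea-1's `stub_decoratedColength_split J a g ha hag`
is `length_quotient_span_mul_sup_span J a g hag`.
-/

-- single-problem summit: the doubled namespace component `ResolutionOfSingularities` is forced
set_option linter.dupNamespace false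

namespace Summit.ResolutionOfSingularities.ResolutionOfSingularities.Theorems.WildQuotientResolution.DecoratedColength

/-- If `a * r ∈ aJ + (g)` and `((g) : a) = (g)`, then `r ∈ J + (g)`. [OURS · L1 W4.5c] [folklore] -/
theorem mem_sup_span_of_mul_mem {R : Type*} [CommRing R] (J : Ideal R) (a g : R)
    (hag : ∀ r : R, a * r ∈ Ideal.span {g} → r ∈ Ideal.span {g}) (r : R)
    (hr : a * r ∈ Ideal.span {a} * J ⊔ Ideal.span {g}) : r ∈ J ⊔ Ideal.span {g} := by
  obtain ⟨x, hx, y, hy, hxy⟩ := Submodule.mem_sup.mp hr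
  obtain ⟨j, hj, rfl⟩ := Ideal.mem_span_singleton_mul.mp hx
  have hdiff : r - j ∈ Ideal.span {g} := by
    refine hag (r - j) ?_
    have h : a * (r - j) = y := by rw [mul_sub, ← hxy]; ring
    rw [h]
    exact hy
  have : r = j + (r - j) := by ring
  rw [this]
  exact Submodule.add_mem_sup hj hdiff

/-- **The decorated colength splits** (card H, step H1): with `((g) : a) = (g)`,
`ℓ(R/(aJ + (g))) = ℓ(R/((a) + (g))) + ℓ(R/(J + (g)))`, from the short exact sequence
`0 → R/(J + (g)) —(·a)→ R/(aJ + (g)) → R/((a) + (g)) → 0`. [OURS · L1 W4.5c] [folklore] -/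
theorem length_quotient_span_mul_sup_span {R : Type*} [CommRing R] (J : Ideal R) (a g : R)
    (hag : ∀ r : R, a * r ∈ Ideal.span {g} → r ∈ Ideal.span {g}) :
    Module.length R (R ⧸ (Ideal.span {a} * J ⊔ Ideal.span {g})) =
      Module.length R (R ⧸ (Ideal.span {a} ⊔ Ideal.span {g})) +
        Module.length R (R ⧸ (J ⊔ Ideal.span {g})) := by
  set I₁ : Ideal R := Ideal.span {a} * J ⊔ Ideal.span {g} with hI₁
  set I₂ : Ideal R := Ideal.span {a} ⊔ Ideal.span {g} with hI₂
  set I₃ : Ideal R := J ⊔ Ideal.span {g} with hI₃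
  have h12 : I₁ ≤ I₂ := sup_le_sup_right Ideal.mul_le_right _
  -- multiplication by `a` followed by the projection to `R ⧸ I₁` kills `I₃`
  have hwd : I₃ ≤ LinearMap.ker ((Submodule.mkQ I₁).comp (LinearMap.mulLeft R a)) := by
    intro r hr
    rw [LinearMap.mem_ker, LinearMap.comp_apply, Submodule.mkQ_apply, LinearMap.mulLeft_apply,
      Submodule.Quotient.mk_eq_zero]
    obtain ⟨j, hj, s, hs, rfl⟩ := Submodule.mem_sup.mp hr
    rw [mul_add]
    exact Submodule.add_mem_sup (Ideal.mul_mem_mul (Ideal.mem_span_singleton_self a) hj)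
      (Ideal.mul_mem_left _ _ hs)
  let f : (R ⧸ I₃) →ₗ[R] (R ⧸ I₁) := Submodule.liftQ I₃ _ hwd
  let π : (R ⧸ I₁) →ₗ[R] (R ⧸ I₂) := Submodule.mapQ I₁ I₂ LinearMap.id h12
  have hf_apply : ∀ r : R, f (Submodule.Quotient.mk r) = Submodule.Quotient.mk (a * r) := fun r => rfl
  have hπ_apply : ∀ x : R, π (Submodule.Quotient.mk x) = Submodule.Quotient.mk x := fun x => rfl
  -- `f` is injective: the colon hypothesis
  have hf : Function.Injective f := by
    rw [← LinearMap.ker_eq_bot]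
    refine Submodule.ker_liftQ_eq_bot _ _ _ ?_
    intro r hr
    rw [LinearMap.mem_ker, LinearMap.comp_apply, Submodule.mkQ_apply, LinearMap.mulLeft_apply,
      Submodule.Quotient.mk_eq_zero] at hr
    exact mem_sup_span_of_mul_mem J a g hag r hr
  -- `π` is surjective
  have hπ : Function.Surjective π := by
    intro y
    obtain ⟨x, rfl⟩ := Submodule.mkQ_surjective I₂ y
    exact ⟨Submodule.Quotient.mk x, rfl⟩
  -- exactness in the middle
  have hex : Function.Exact f π := by
    intro y
    obtain ⟨x, rfl⟩ := Submodule.mkQ_surjective I₁ y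
    rw [Submodule.mkQ_apply, hπ_apply, Submodule.Quotient.mk_eq_zero]
    constructor
    · intro hx
      obtain ⟨u, hu, v, hv, huv⟩ := Submodule.mem_sup.mp hx
      obtain ⟨r, rfl⟩ := Ideal.mem_span_singleton'.mp hu
      refine ⟨Submodule.Quotient.mk r, ?_⟩
      rw [hf_apply, eq_comm, Submodule.Quotient.eq]
      have h : x - a * r = v := by rw [← huv]; ring
      rw [h]
      exact Ideal.mem_sup_right hv
    · rintro ⟨z, hz⟩
      obtain ⟨r, rfl⟩ := Submodule.mkQ_surjective I₃ z
      rw [Submodule.mkQ_apply, hf_apply, Submodule.Quotient.eq] at hz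
      have h : x = a * r - (a * r - x) := by ring
      rw [h]
      exact Submodule.sub_mem _ (Ideal.mem_sup_left (Ideal.mem_span_singleton'.mpr ⟨r, mul_comm r a⟩))
        (h12 hz)
  rw [Module.length_eq_add_of_exact f π hf hπ hex, add_comm]

end Summit.ResolutionOfSingularities.ResolutionOfSingularities.Theorems.WildQuotientResolution.DecoratedColength
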